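import Literature.NumberTheory.Automorphic.GKContragredient
import Literature.NumberTheory.Automorphic.GKSubquotient
import HarnessLib

/-!
# The contragredient on sub- and quotient modules: restriction `Ṽ → Ũ`, inflation `(V/U)~ → Ṽ`, and exactness at `Ṽ`

Family `hodge`, lane `lit-hodgefound` (foundations library; seat `lit-hodgefound-p39`, generation 31, row g31-#14); topic
`NumberTheory/Automorphic` (next to `GKContragredient`, `GKSubquotient`), namespace `Literature.NumberTheory.Automorphic.GKDual`.  Two
definitions with bodies + theorems; 0 `sorry`, no named fact (net debt 0, D-0026).

For a `(𝔤, K)`-stable subspace `U ⊆ V` (data on `U`: Mathlib's `ρK.subrepresentation U hK` and the trunk's `GKSubmodule.subLie`; on `V ⧸ U`: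
`ρK.quotient U hK`, `GKSubmodule.quotLie`, cf. `GKSubquotient`), the transposes of the inclusion `ι : U → V` and of the projection
`π : V → V/U` restrict to the `K`-finite duals: **`resCarrier : Ṽ → Ũ`, `ℓ ↦ ℓ ∘ ι`** and **`infCarrier : (V/U)~ → Ṽ`, `λ ↦ λ ∘ π`** — they
carry `K`-orbits to `K`-orbits (`dualMap_subtype_mem_carrier`, `dualMap_mkQ_mem_carrier`) —, both are `(𝔤, K)`-maps for the restricted data
`(Kfin, lieFin)` (`resCarrier_Kfin/_lieFin`, `infCarrier_Kfin/_lieFin`), `infCarrier` is injective and **`0 → (V/U)~ → Ṽ → Ũ` is exact**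
(`exact_infCarrier_resCarrier`: a `K`-finite functional vanishing on `U` descends to `V/U`, and the descended functional is `K`-finite because
`λ ↦ λ ∘ π` is injective and intertwining).  «The results of §II.3 showed that this functor [the contragredient] is contravariant and exact»
[KnappVogan1995, §VI.2 (before (6.7)); §II.3 Prop. 2.53 (b)]; [BorelWallach2000, 0 §2.5].  The surjectivity of `Ṽ → Ũ` (right
exactness) needs `K`-type bookkeeping and is proved where `K`-types are available (`U(1,1)`: `BorelWallach2000/U11ContragredientExact`).

## What is formalised

`dualMap_subtype_mem_carrier`, **`resCarrier`** (+ `coe_resCarrier_apply`, `resCarrier_Kfin`, `resCarrier_lieFin`), `dualMap_mkQ_mem_carrier`,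
**`infCarrier`** (+ `coe_infCarrier_apply`, `infCarrier_Kfin`, `infCarrier_lieFin`), `infCarrier_injective`, `resCarrier_comp_infCarrier`
(`= 0`), `mem_range_infCarrier_iff` (`ℓ ∈ im ⟺ ℓ|_U = 0`), **`exact_infCarrier_resCarrier`**.

## References

* A. W. Knapp, D. A. Vogan, *Cohomological Induction and Unitary Representations*, Princeton Math. Ser. 45 (1995), §II.3 (2.42) ff., 2),
  Prop. 2.53 (b); §VI.2 (before (6.7)). [KnappVogan1995]
* A. Borel, N. Wallach, *Continuous Cohomology, Discrete Subgroups, and Representations of Reductive Groups*, 2nd ed., Math. Surveys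
  Monogr. 67, AMS (2000), 0 §2.5. [BorelWallach2000]
-/

noncomputable section

namespace Literature.NumberTheory.Automorphic

open Module

-- Mathlib idiom (as in `GKModules`, `GKContragredient`): commutator bracket on `Module.End`
attribute [local instance 100] LieRing.ofAssociativeRing

variable {A : Type*} [NormedCommRing A] [NormedAlgebra ℝ A] [NormedAlgebra ℚ A] [CompleteSpace A]
  [StarRing A] {N : Type*} [Fintype N] [DecidableEq N] (G : RealMatrixGroup A N)
  {V : Type*} [AddCommGroup V] [Module ℂ V]
  (ρK : Representation ℂ G.maximalCompact V) (ρ𝔤 : G.lie →ₗ⁅ℝ⁆ Module.End ℂ V)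
  (U : Submodule ℂ V) (hK : ∀ k : G.maximalCompact, U ≤ U.comap (ρK k))

namespace GKDual

/-! ## §1 Restriction `Ṽ → Ũ` -/

/-- **`ℓ ↦ ℓ ∘ ι` carries `K`-finite functionals on `V` to `K`-finite functionals on `U`** (it intertwines the contragredient `K`-actions,
so the `K`-orbit of `ℓ ∘ ι` is the image of the `K`-orbit of `ℓ`). [cite: KnappVogan1995, §II.3 (2.42) ff., 2)] [cite: BorelWallach2000, 0 §2.5] -/
theorem dualMap_subtype_mem_carrier {ℓ : Dual ℂ V} (hℓ : ℓ ∈ carrier G ρK) :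
    U.subtype.dualMap ℓ ∈ carrier G (ρK.subrepresentation U hK) := by
  rw [mem_kFiniteVectors_iff] at hℓ ⊢
  have hfun : (fun k : G.maximalCompact ↦ (ρK.subrepresentation U hK).dual k (U.subtype.dualMap ℓ)) =
      U.subtype.dualMap ∘ fun k ↦ ρK.dual k ℓ :=
    funext fun k => LinearMap.ext fun u => rfl
  rw [hfun, Set.range_comp, ← Submodule.map_span]
  exact Module.Finite.map _ _

/-- **Restriction of `K`-finite functionals: `resCarrier : Ṽ → Ũ`, `ℓ ↦ ℓ|_U`** (the contragredient functor on the inclusion `U ⊆ V`).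
[cite: KnappVogan1995, §II.3 (2.42) ff., 2)] [cite: BorelWallach2000, 0 §2.5] -/
def resCarrier : carrier G ρK →ₗ[ℂ] carrier G (ρK.subrepresentation U hK) :=
  U.subtype.dualMap.restrict fun _ hℓ => dualMap_subtype_mem_carrier G ρK U hK hℓ

/-- `(resCarrier ℓ)(u) = ℓ(u)`. [cite: KnappVogan1995, §II.3 (2.42) ff., 2)] -/
@[simp] theorem coe_resCarrier_apply (ℓ : carrier G ρK) (u : U) :
    ((resCarrier G ρK U hK ℓ : carrier G (ρK.subrepresentation U hK)) : Dual ℂ U) u = (ℓ : Dual ℂ V) u := rfl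

/-- `resCarrier` is a `K`-map. [cite: BorelWallach2000, 0 §2.5] -/
theorem resCarrier_Kfin (k : G.maximalCompact) (ℓ : carrier G ρK) :
    resCarrier G ρK U hK (Kfin G ρK k ℓ) = Kfin G (ρK.subrepresentation U hK) k (resCarrier G ρK U hK ℓ) :=
  Subtype.ext (LinearMap.ext fun _ => rfl)

/-- `resCarrier` is a `𝔤`-map. [cite: BorelWallach2000, 0 §2.5] -/
theorem resCarrier_lieFin [Module.Finite ℝ G.lie] (h𝔤 : ∀ X : G.lie, U ≤ U.comap (ρ𝔤 X))
    (had : ∀ (k : G.maximalCompact) (X : G.lie),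
      ρK k ∘ₗ ρ𝔤 X ∘ₗ ρK k⁻¹ = ρ𝔤 (G.Ad (Subgroup.inclusion G.maximalCompact_le_carrier k) X))
    (hadU : ∀ (k : G.maximalCompact) (X : G.lie),
      ρK.subrepresentation U hK k ∘ₗ GKSubmodule.subLie G ρ𝔤 U h𝔤 X ∘ₗ ρK.subrepresentation U hK k⁻¹ =
        GKSubmodule.subLie G ρ𝔤 U h𝔤 (G.Ad (Subgroup.inclusion G.maximalCompact_le_carrier k) X))
    (X : G.lie) (ℓ : carrier G ρK) :
    resCarrier G ρK U hK (lieFin G ρK ρ𝔤 had X ℓ) =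
      lieFin G (ρK.subrepresentation U hK) (GKSubmodule.subLie G ρ𝔤 U h𝔤) hadU X (resCarrier G ρK U hK ℓ) :=
  Subtype.ext (LinearMap.ext fun _ => rfl)

/-! ## §2 Inflation `(V/U)~ → Ṽ` -/

/-- **`λ ↦ λ ∘ π` carries `K`-finite functionals on `V ⧸ U` to `K`-finite functionals on `V`.** [cite: KnappVogan1995, §II.3 (2.42) ff., 2)]
[cite: BorelWallach2000, 0 §2.5] -/
theorem dualMap_mkQ_mem_carrier {μ : Dual ℂ (V ⧸ U)} (hμ : μ ∈ carrier G (ρK.quotient U hK)) :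
    U.mkQ.dualMap μ ∈ carrier G ρK := by
  rw [mem_kFiniteVectors_iff] at hμ ⊢
  have hfun : (fun k : G.maximalCompact ↦ ρK.dual k (U.mkQ.dualMap μ)) =
      U.mkQ.dualMap ∘ fun k ↦ (ρK.quotient U hK).dual k μ :=
    funext fun k => LinearMap.ext fun v => rfl
  rw [hfun, Set.range_comp, ← Submodule.map_span]
  exact Module.Finite.map _ _

/-- **Inflation of `K`-finite functionals: `infCarrier : (V/U)~ → Ṽ`, `λ ↦ λ ∘ π`** (the contragredient functor on the projection
`V → V/U`). [cite: KnappVogan1995, §II.3 (2.42) ff., 2)] [cite: BorelWallach2000, 0 §2.5] -/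
def infCarrier : carrier G (ρK.quotient U hK) →ₗ[ℂ] carrier G ρK :=
  U.mkQ.dualMap.restrict fun _ hμ => dualMap_mkQ_mem_carrier G ρK U hK hμ

/-- `(infCarrier λ)(v) = λ(v + U)`. [cite: KnappVogan1995, §II.3 (2.42) ff., 2)] -/
@[simp] theorem coe_infCarrier_apply (μ : carrier G (ρK.quotient U hK)) (v : V) :
    ((infCarrier G ρK U hK μ : carrier G ρK) : Dual ℂ V) v = (μ : Dual ℂ (V ⧸ U)) (Submodule.Quotient.mk v) := rfl

/-- `infCarrier` is a `K`-map. [cite: BorelWallach2000, 0 §2.5] -/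
theorem infCarrier_Kfin (k : G.maximalCompact) (μ : carrier G (ρK.quotient U hK)) :
    infCarrier G ρK U hK (Kfin G (ρK.quotient U hK) k μ) = Kfin G ρK k (infCarrier G ρK U hK μ) :=
  Subtype.ext (LinearMap.ext fun _ => rfl)

/-- `infCarrier` is a `𝔤`-map. [cite: BorelWallach2000, 0 §2.5] -/
theorem infCarrier_lieFin [Module.Finite ℝ G.lie] (h𝔤 : ∀ X : G.lie, U ≤ U.comap (ρ𝔤 X))
    (had : ∀ (k : G.maximalCompact) (X : G.lie),
      ρK k ∘ₗ ρ𝔤 X ∘ₗ ρK k⁻¹ = ρ𝔤 (G.Ad (Subgroup.inclusion G.maximalCompact_le_carrier k) X))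
    (hadQ : ∀ (k : G.maximalCompact) (X : G.lie),
      ρK.quotient U hK k ∘ₗ GKSubmodule.quotLie G ρ𝔤 U h𝔤 X ∘ₗ ρK.quotient U hK k⁻¹ =
        GKSubmodule.quotLie G ρ𝔤 U h𝔤 (G.Ad (Subgroup.inclusion G.maximalCompact_le_carrier k) X))
    (X : G.lie) (μ : carrier G (ρK.quotient U hK)) :
    infCarrier G ρK U hK (lieFin G (ρK.quotient U hK) (GKSubmodule.quotLie G ρ𝔤 U h𝔤) hadQ X μ) =
      lieFin G ρK ρ𝔤 had X (infCarrier G ρK U hK μ) :=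
  Subtype.ext (LinearMap.ext fun _ => rfl)

/-- **`infCarrier` is injective** (`π` is onto). [cite: KnappVogan1995, §II.3 Prop. 2.53 (b)] -/
theorem infCarrier_injective : Function.Injective (infCarrier G ρK U hK) := fun _ _ h =>
  Subtype.ext (LinearMap.dualMap_injective_of_surjective (Submodule.mkQ_surjective U) (congrArg Subtype.val h))

/-! ## §3 Exactness at `Ṽ` -/

/-- `(λ ∘ π)|_U = 0`. [cite: KnappVogan1995, §II.3 Prop. 2.53 (b)] -/
theorem resCarrier_comp_infCarrier : resCarrier G ρK U hK ∘ₗ infCarrier G ρK U hK = 0 := by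
  refine LinearMap.ext fun μ => Subtype.ext (LinearMap.ext fun u => ?_)
  change (μ : Dual ℂ (V ⧸ U)) (Submodule.Quotient.mk (u : V)) = 0
  rw [(Submodule.Quotient.mk_eq_zero U).mpr u.2, map_zero]

/-- **A `K`-finite functional vanishing on `U` is inflated from a `K`-finite functional on `V ⧸ U`** (it descends to `V ⧸ U`, and the
descended functional is `K`-finite because `λ ↦ λ ∘ π` is injective and intertwines the `K`-actions).
[cite: KnappVogan1995, §II.3 Prop. 2.53 (b)] [cite: BorelWallach2000, 0 §2.5] -/
theorem mem_range_infCarrier_iff (ℓ : carrier G ρK) :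
    ℓ ∈ LinearMap.range (infCarrier G ρK U hK) ↔ resCarrier G ρK U hK ℓ = 0 := by
  constructor
  · rintro ⟨μ, rfl⟩
    exact LinearMap.congr_fun (resCarrier_comp_infCarrier G ρK U hK) μ
  · intro h
    -- `ℓ` kills `U`, so it descends: `ℓ = μ ∘ π` with `μ = liftQ ℓ`
    have hU : U ≤ LinearMap.ker (ℓ : Dual ℂ V) := fun u hu =>
      (congrArg (fun x : carrier G (ρK.subrepresentation U hK) => (x : Dual ℂ U) ⟨u, hu⟩) h :)
    let μ : Dual ℂ (V ⧸ U) := U.liftQ (ℓ : Dual ℂ V) hU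
    have hμℓ : U.mkQ.dualMap μ = (ℓ : Dual ℂ V) := LinearMap.ext fun v => rfl
    -- `μ` is `K`-finite: its `K`-orbit maps injectively onto the `K`-orbit of `ℓ`
    have hμ : μ ∈ carrier G (ρK.quotient U hK) := by
      rw [mem_kFiniteVectors_iff]
      have hℓ := (mem_kFiniteVectors_iff G ρK.dual (ℓ : Dual ℂ V)).mp ℓ.2
      have hfun : (fun k : G.maximalCompact ↦ ρK.dual k (ℓ : Dual ℂ V)) =
          U.mkQ.dualMap ∘ fun k ↦ (ρK.quotient U hK).dual k μ := by
        funext k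
        rw [← hμℓ]
        exact LinearMap.ext fun v => rfl
      rw [hfun, Set.range_comp, ← Submodule.map_span] at hℓ
      haveI := hℓ
      exact Module.Finite.equiv (Submodule.equivMapOfInjective _
        (LinearMap.dualMap_injective_of_surjective (Submodule.mkQ_surjective U)) _).symm
    exact ⟨⟨μ, hμ⟩, Subtype.ext hμℓ⟩

/-- **`0 → (V/U)~ → Ṽ → Ũ` is exact at `Ṽ`** («the contragredient functor is exact»; with `infCarrier_injective`; right exactness at
`U(1,1)` in `BorelWallach2000/U11ContragredientExact`). [cite: KnappVogan1995, §II.3 Prop. 2.53 (b), §VI.2 (before (6.7))]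
[cite: BorelWallach2000, 0 §2.5] -/
theorem exact_infCarrier_resCarrier : Function.Exact (infCarrier G ρK U hK) (resCarrier G ρK U hK) :=
  fun ℓ => ⟨fun h => (mem_range_infCarrier_iff G ρK U hK ℓ).mpr h, fun h => (mem_range_infCarrier_iff G ρK U hK ℓ).mp h⟩

end GKDual

end Literature.NumberTheory.Automorphic
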